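import Summits.ABC.StewartYu.PadicG3ClauseC
import Summits.ABC.StewartYu.PadicG3ExitB
import HarnessLib

/-!
# Cell abc-stewartyu, Gen-3 record (WP-M3.R): `RecordTwo` / `RecordOdd` BY NAME for the parameter record
# `PadicG3Par` — exits A, B as tree theorems, clause (C) modulo the two constant comparisons

`Summits/ABC/StewartYu/GenThreeRecordNumerics.lean` — cell `abc-stewartyu` (HOME
`run/shared/lean/pub/abc-stewartyu/`), route `PadicPrimesKummerThird`, cruxes `Y07Odd` (stmt-ABC-19658) /
`Y07Two` (stmt-ABC-19659); seat lp-1 (g2), record parcels (R2)+(R3).  Theorems only.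

The record predicates the frames consume — `GenThreeFrameSpecTwo.RecordTwo C n V Vmax W D₀ S₀ X D` and
`GenThreeFrameSpecOdd.RecordOdd C p n V Vmax W D₀ S₀ X D` (Nesterenko's (5.14)–(5.17), Lemma 5.4 and the
(5.22) cost line, quantified over all obstruction lattices) — for the END parameters of `P : PadicG3Par n`
with `V := P.A`:

  `(D₀, S₀, X, D) := (P.D₀, P.S₀N, P.Xfin, P.D)`.

Assembled from p4's `RecordAssembly.recordTwo_of_ineqs` / `recordOdd_of_ineqs` with
`hA := PadicG3Par.exitA` (tree), `hB := PadicG3Par.exitB hKNq` (tree), `hCineq := PadicG3Par.exitC_two/odd`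
(tree, conditional on the constant comparisons `NC1`, `NC0` of `PadicG3ExitC` — pure real inequalities in
`n, r`, hypotheses `hnum1`, `hnum0` here; their kernel proof is the last open piece of the record's numerics).

Hypotheses = the RULED instantiation convention (plan g8 2026-08-27T01:00:18Z): `K ≤ N_q ≤ 2ⁿK`, `½ ≤ θ₀`,
`Amax ≤ 2ⁿΩ`, the frames' height floor `1 ≤ Aⱼ`, and an admissible `C` with `0 ≤ C r` and the geometric
growth `256^{n−r}·C r ≤ C n` for `r < n` (e.g. `C m = c₁^m`, `c₁ ≥ 256`).

WHAT THIS IS NOT: no crux moves; `RecordTwo`/`RecordOdd` still carry the two numeric hypotheses.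

References: Yu. V. Nesterenko, LNM 1819 (2003), §5.2 (5.13)–(5.22), Lemmas 5.3, 5.4; Prop. 2.6.
-/

noncomputable section

open Finset Real Nat

namespace Summit.ABC.StewartYu

namespace PadicG3Par

open Summit.ABC.StewartYu.GenThreeFrameSpecTwo (RecordTwo)
open Summit.ABC.StewartYu.GenThreeFrameSpecOdd (RecordOdd)

variable {n : ℕ} (P : PadicG3Par n)

/-- **`RecordTwo` by name for `PadicG3Par`** (modulo the constant comparisons `NC1`/`NC0`).
[cite: Nesterenko2003, §5.2 (5.13)–(5.22), Lemmas 5.3–5.4] -/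
theorem recordTwo_of_numeric (hKNq : P.K ≤ P.Nq) (hNqK : P.Nq ≤ 2 ^ n * P.K) (hθ : (1 / 2 : ℝ) ≤ P.θ₀)
    (hAmax : P.Amax ≤ 2 ^ n * P.Ω) (hA1 : ∀ j, 1 ≤ P.A j)
    {C : ℕ → ℝ} (hC0 : ∀ r, 0 ≤ C r) (hCg : ∀ r, r < n → (256 : ℝ) ^ (n - r) * C r ≤ C n)
    (hnum1 : ∀ r : ℕ, 0 < r → r < n →
      ((r ! : ℕ) : ℝ) ^ 2 * (n : ℝ) ^ r * (((n + 1)! : ℕ) : ℝ) * 2 ^ r * (((r - 1)! : ℕ) : ℝ) *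
          (((2 : ℝ) ^ (n + 23))⁻¹ + 2 ^ n / (24 * Cb ^ n)) ^ r * (264 * Cb ^ n + 2 ^ (2 * n + 26)) *
          (14 * n + 3) ≤
        (256 : ℝ) ^ (n - r) * (16 * ((n : ℝ) + 1) / ((n : ℝ) + 2) ^ 4) ^ (r - 1) * 2 ^ (n + 22) *
          (((n - r + 1)! : ℕ) : ℝ))
    (hnum0 : ∀ r : ℕ, 0 < r → r < n →
      ((r ! : ℕ) : ℝ) ^ 3 * (n : ℝ) ^ r * (((n + 1)! : ℕ) : ℝ) * 2 ^ (r - 1) *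
          (((2 : ℝ) ^ (n + 23))⁻¹ + 2 ^ n / (24 * Cb ^ n)) ^ r * (264 * Cb ^ n + 2 ^ (2 * n + 26)) *
          (14 * n + 3) ≤
        (256 : ℝ) ^ (n - r) * (16 * ((n : ℝ) + 1) / ((n : ℝ) + 2) ^ 4) ^ r * 2 ^ (n + 22) *
          (((n - r)! : ℕ) : ℝ)) :
    RecordTwo C n P.A P.Amax P.W P.D₀ P.S₀N P.Xfin P.D :=
  RecordExits.recordTwo_of_ineqs hC0 P.hn hA1 P.hAmax1 (by linarith [P.hW])
    (by unfold D₀; omega) P.one_le_D P.D_le_Dmax P.D_mul_A_le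
    P.exitA (P.exitB hKNq) (P.exitC_two hKNq hNqK hθ hAmax hA1 hC0 hCg hnum1 hnum0)

/-- **`RecordOdd` by name for `PadicG3Par`** (any `p`; modulo the constant comparisons `NC1`/`NC0`).
[cite: Nesterenko2003, §5.2 (5.13)–(5.22), Lemmas 5.3–5.4] -/
theorem recordOdd_of_numeric (hKNq : P.K ≤ P.Nq) (hNqK : P.Nq ≤ 2 ^ n * P.K) (hθ : (1 / 2 : ℝ) ≤ P.θ₀)
    (hAmax : P.Amax ≤ 2 ^ n * P.Ω) (hA1 : ∀ j, 1 ≤ P.A j) (p : ℕ)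
    {C : ℕ → ℝ} (hC0 : ∀ r, 0 ≤ C r) (hCg : ∀ r, r < n → (256 : ℝ) ^ (n - r) * C r ≤ C n)
    (hnum1 : ∀ r : ℕ, 0 < r → r < n →
      ((r ! : ℕ) : ℝ) ^ 2 * (n : ℝ) ^ r * (((n + 1)! : ℕ) : ℝ) * 2 ^ r * (((r - 1)! : ℕ) : ℝ) *
          (((2 : ℝ) ^ (n + 23))⁻¹ + 2 ^ n / (24 * Cb ^ n)) ^ r * (264 * Cb ^ n + 2 ^ (2 * n + 26)) *
          (14 * n + 3) ≤
        (256 : ℝ) ^ (n - r) * (16 * ((n : ℝ) + 1) / ((n : ℝ) + 2) ^ 4) ^ (r - 1) * 2 ^ (n + 22) *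
          (((n - r + 1)! : ℕ) : ℝ))
    (hnum0 : ∀ r : ℕ, 0 < r → r < n →
      ((r ! : ℕ) : ℝ) ^ 3 * (n : ℝ) ^ r * (((n + 1)! : ℕ) : ℝ) * 2 ^ (r - 1) *
          (((2 : ℝ) ^ (n + 23))⁻¹ + 2 ^ n / (24 * Cb ^ n)) ^ r * (264 * Cb ^ n + 2 ^ (2 * n + 26)) *
          (14 * n + 3) ≤
        (256 : ℝ) ^ (n - r) * (16 * ((n : ℝ) + 1) / ((n : ℝ) + 2) ^ 4) ^ r * 2 ^ (n + 22) *
          (((n - r)! : ℕ) : ℝ)) :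
    RecordOdd C p n P.A P.Amax P.W P.D₀ P.S₀N P.Xfin P.D :=
  RecordExits.recordOdd_of_ineqs hC0 P.hn hA1 P.hAmax1 (by linarith [P.hW])
    (by unfold D₀; omega) P.one_le_D P.D_le_Dmax P.D_mul_A_le
    P.exitA (P.exitB hKNq) (P.exitC_odd hKNq hNqK hθ hAmax hA1 p hC0 hCg hnum1 hnum0)

end PadicG3Par

end Summit.ABC.StewartYu

end
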